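import Literature.NumberTheory.EllipticCurves.NeronComponentIndexTypeI0starProofs
import Literature.NumberTheory.DiophantineGeometry.TateAlgorithmIstarSuccNormalFormProofs
import HarnessLib

/-!
# The local index for type `Iₙ*`, `n ≥ 1`: `c_v ∈ {2, 4}` (proof)

Discharge of the named fact
`Literature.NumberTheory.EllipticCurves.localTamagawaNumber_of_kodairaSymbolAt_eq_Istar_succ`
(`NeronComponentIndex.lean`; Silverman, *ATAEC*, IV.9.4 Step 7, PDF p. 345: "Type `Iₙ*`, …,
`c = 2` or `4`"), by the elementary tools of `LocalIndexBadPoints.lean`; no Néron model is used.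

## Proof

Over a Henselian discrete valuation ring with perfect residue field, if Tate's algorithm returns
`Istar (n + 1)` on `I` (`Δ ≠ 0`), some `R`-model `J = D • I` has `a₁ = πα`, `a₂ = πp` with
`p ∈ Rˣ`, `π² ∣ a₃`, `π³ ∣ a₄`, `π⁴ ∣ a₆`
(`exists_smul_of_kodairaSymbolOfMinimal_eq_Istar_succ`); its cubic is `T²(T + p̄)`, and bad points `(πx₁, π²y₂)` have `x̄₁²(x̄₁ + p̄) = 0`: they lie over the
simple root `−p̄` (side `S`) or over the double root `0` (side `D`). Two points of side `S` add
up into `E₀(K)` (`hasNonsingularReduction_add_of_same_root`, `P'(−p̄) = p̄² ≠ 0`), and one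
exists, `(πt, 0)` with `t` a Hensel root of `T³ + pT² + (a₄/π²)T + a₆/π³` near `−p`: side `S` is
one class `s ≠ 0` with `2s = 0`. The sum of two points of side `D` is in `E₀(K)` or of side `S`
(`add_of_side_D`: `λ ∈ 𝔪` gives `x₃ ≡ −a₂ (mod 𝔪²)`). Hence all classes lie in
`{0, s, d, d + s}`, so the order is `2` or `4`; nothing about the later rounds of the
sub-procedure of Step 7 is used. The index is the same for `I`, and this is `c_v` at `v`.

## References

* J. H. Silverman, *Advanced Topics in the Arithmetic of Elliptic Curves*, GTM 151, Springer
  1994, IV.9.4 Step 7 (PDF p. 345) and its proof (PDF pp. 350–352; Table 4.1: component group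
  `(ℤ/2ℤ)²` or `ℤ/4ℤ`). [SilvermanATAEC1994]
-/

noncomputable section

open scoped Classical

open IsLocalRing Polynomial

namespace Literature.NumberTheory.EllipticCurves

namespace LocalIndex

open DiophantineGeometry DiophantineGeometry.TateAlgorithm

variable {R : Type*} [CommRing R] [IsDomain R] [IsDiscreteValuationRing R]
  {K : Type*} [Field K] [Algebra R K] [IsFractionRing R K]

/-! ### Points with `x ∈ 𝔪` are bad; sums of points over the double root -/

/-- If `a₃, a₄, a₆ ∈ 𝔪`, an affine point whose `x`-coordinate lies in `𝔪` reduces to `(0, 0)`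
(its `y`-coordinate is integral with `ȳ² = 0`), so it has singular reduction. [folklore] -/
theorem not_hasNonsingularReduction_of_X_mem (J : WeierstrassCurve R)
    (h3 : J.a₃ ∈ maximalIdeal R) (h4 : J.a₄ ∈ maximalIdeal R) (h6 : J.a₆ ∈ maximalIdeal R)
    {a : R} (ha : a ∈ maximalIdeal R) {x y : K} (h : (J.baseChange K).toAffine.Nonsingular x y)
    (hx : x = algebraMap R K a) : ¬ J.HasNonsingularReduction (.some _ _ h) := by
  have hv := integers_valuationRing_valuation R K
  have hinj := IsFractionRing.injective R K
  subst hx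
  obtain ⟨b, hb⟩ := hv.exists_of_le_one (v_Y_le_one_of_v_X_le_one hv h.1 (hv.map_le_one a))
  have he' := h.left
  rw [← hb] at he'
  have he : J.toAffine.Equation a b := (WeierstrassCurve.Affine.map_equation _ hinj a b).mp he'
  have hbm : b ∈ maximalIdeal R := by
    rw [WeierstrassCurve.Affine.equation_iff] at he
    have hsq : b ^ 2 ∈ maximalIdeal R := by
      have e : b ^ 2 = a ^ 3 + J.a₂ * a ^ 2 + J.a₄ * a + J.a₆ - J.a₁ * a * b - J.a₃ * b := by
        linear_combination he
      rw [e]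
      refine Ideal.sub_mem _ (Ideal.sub_mem _ (Ideal.add_mem _ (Ideal.add_mem _ (Ideal.add_mem _
        (Ideal.pow_mem_of_mem _ ha 3 three_pos) (Ideal.mul_mem_left _ _
        (Ideal.pow_mem_of_mem _ ha 2 two_pos))) (Ideal.mul_mem_left _ _ ha)) h6)
        (Ideal.mul_mem_right _ _ (Ideal.mul_mem_left _ _ ha))) (Ideal.mul_mem_right _ _ h3)
    exact Ideal.IsPrime.mem_of_pow_mem inferInstance 2 hsq
  rw [hasNonsingularReduction_some_iff_of_eq J h rfl hb.symm]
  exact (hasNonsingularReduction_some_iff_of_eq J (hb ▸ h :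
    (J.baseChange K).toAffine.Nonsingular (algebraMap R K a) (algebraMap R K b)) rfl rfl).not.mp
    (not_hasNonsingularReduction_some J h3 h4 ha hbm _)

/-- **The sum of two points over the double root** (`a₁ ∈ 𝔪`, `a₂ = πp` with `p ∈ Rˣ`,
`a₃, a₄, a₆ ∈ 𝔪`): if `P = (πx₁, y)`, `P' = (πx₁', y')` with `x₁, x₁' ∈ 𝔪`, then `P + P'` has
nonsingular reduction or is an affine point `(πX, Y)` with `X̄ = −p̄` (according as the slope has
`v < 0`, is a unit, or lies in `𝔪`). [cite: SilvermanATAEC1994, IV.9.4 Step 7] -/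
theorem add_of_side_D (J : WeierstrassCurve R) {ϖ p : R} (hϖ : Irreducible ϖ)
    (h1 : J.a₁ ∈ maximalIdeal R) (hp : J.a₂ = ϖ * p) (h3 : J.a₃ ∈ maximalIdeal R)
    (h4 : J.a₄ ∈ maximalIdeal R) (h6 : J.a₆ ∈ maximalIdeal R) {x₁ x₁' : R}
    (hx₁ : x₁ ∈ maximalIdeal R) (hx₁' : x₁' ∈ maximalIdeal R) {y y' : K}
    (h₁ : (J.baseChange K).toAffine.Nonsingular (algebraMap R K (ϖ * x₁)) y)
    (h₂ : (J.baseChange K).toAffine.Nonsingular (algebraMap R K (ϖ * x₁')) y') :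
    J.HasNonsingularReduction
        (WeierstrassCurve.Affine.Point.some _ _ h₁ + WeierstrassCurve.Affine.Point.some _ _ h₂) ∨
      ∃ (X : R) (Y : K) (h₃ : (J.baseChange K).toAffine.Nonsingular (algebraMap R K (ϖ * X)) Y),
        WeierstrassCurve.Affine.Point.some _ _ h₁ + WeierstrassCurve.Affine.Point.some _ _ h₂ =
          WeierstrassCurve.Affine.Point.some _ _ h₃ ∧ residue R X = -residue R p := by
  have hv := integers_valuationRing_valuation R K
  have hinj := IsFractionRing.injective R K
  set f := algebraMap R K with hf
  have hm : ϖ ∈ maximalIdeal R := (IsLocalRing.mem_maximalIdeal _).mpr hϖ.not_isUnit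
  have h2 : J.a₂ ∈ maximalIdeal R := hp ▸ Ideal.mul_mem_right _ _ hm
  by_cases hxy : f (ϖ * x₁) = f (ϖ * x₁') ∧ y = (J.baseChange K).toAffine.negY (f (ϖ * x₁')) y'
  · left; rw [WeierstrassCurve.Affine.Point.add_of_Y_eq hxy.1 hxy.2]; trivial
  rw [WeierstrassCurve.Affine.Point.add_some hxy]
  set L := (J.baseChange K).toAffine.slope (f (ϖ * x₁)) (f (ϖ * x₁')) y y' with hL
  by_cases hLv : 1 < ValuationRing.valuation R K L
  · -- `v(λ) < 0`: reduction `𝒪`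
    exact Or.inl (Or.inl ((not_mem_range_iff hv).mpr
      (one_lt_v_addX_of_one_lt_v_slope hv (hv.map_le_one _) (hv.map_le_one _) hLv)))
  obtain ⟨ℓ, hℓ⟩ := hv.exists_of_le_one (not_lt.mp hLv)
  have hX : (J.baseChange K).toAffine.addX (f (ϖ * x₁)) (f (ϖ * x₁')) L =
      f (ℓ ^ 2 + J.a₁ * ℓ - J.a₂ - ϖ * x₁ - ϖ * x₁') := by
    rw [WeierstrassCurve.Affine.addX, ← hℓ]; simp [WeierstrassCurve.baseChange, ← hf]
  by_cases hℓu : IsUnit ℓ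
  · -- `λ ∈ Rˣ`: unit `x`-coordinate
    left
    refine hasNonsingularReduction_some_of_isUnit J h3 h4 h6 ?_ _ hX
    refine IsLocalRing.notMem_maximalIdeal.mp fun hmem => IsLocalRing.notMem_maximalIdeal.mpr hℓu ?_
    have hsq : ℓ ^ 2 ∈ maximalIdeal R := by
      have e : ℓ ^ 2 = (ℓ ^ 2 + J.a₁ * ℓ - J.a₂ - ϖ * x₁ - ϖ * x₁') - J.a₁ * ℓ + J.a₂ + ϖ * x₁ +
        ϖ * x₁' := by ring
      rw [e]
      exact Ideal.add_mem _ (Ideal.add_mem _ (Ideal.add_mem _ (Ideal.sub_mem _ hmem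
        (Ideal.mul_mem_right _ _ h1)) h2) (Ideal.mul_mem_right _ _ hm)) (Ideal.mul_mem_right _ _ hm)
    exact Ideal.IsPrime.mem_of_pow_mem inferInstance 2 hsq
  · -- `λ ∈ 𝔪`: `x₃ ≡ -a₂ (mod 𝔪²)`, side `S`
    right
    have hℓm : ℓ ∈ maximalIdeal R := (IsLocalRing.mem_maximalIdeal _).mpr hℓu
    obtain ⟨ℓ₁, rfl⟩ := (mem_maximalIdeal_iff_dvd_of_irreducible hϖ ℓ).mp hℓm
    obtain ⟨α, hα⟩ := (mem_maximalIdeal_iff_dvd_of_irreducible hϖ _).mp h1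
    set X : R := ϖ * ℓ₁ ^ 2 + ϖ * α * ℓ₁ - p - x₁ - x₁' with hXdef
    have hX' : (J.baseChange K).toAffine.addX (f (ϖ * x₁)) (f (ϖ * x₁')) L = f (ϖ * X) := by
      rw [hX, hα, hp, hXdef]; congr 1; ring
    refine ⟨X, _, hX' ▸ WeierstrassCurve.Affine.nonsingular_add h₁ h₂ hxy,
      point_some_congr hX' rfl, ?_⟩
    rw [hXdef]
    simp only [map_sub, map_add, map_mul, (residue_eq_zero_iff _).mpr hm,
      (residue_eq_zero_iff _).mpr hx₁, (residue_eq_zero_iff _).mpr hx₁', zero_mul, add_zero,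
      sub_zero, zero_sub]

/-! ### The index for the normal form -/

/-- **`[E(K) : E₀(K)] ∈ {2, 4}` for the normal form of type `Iₙ*`, `n ≥ 1`** (`a₁ ∈ 𝔪`,
`π ∥ a₂`, `π² ∣ a₃`, `π³ ∣ a₄`, `π⁴ ∣ a₆`, `Δ ≠ 0`) over a Henselian discrete valuation ring: the
classes lie in `{0, s, d, d + s}`, `s` of order `2`. [cite: SilvermanATAEC1994, IV.9.4 Step 7] -/
theorem index_mem_of_normalForm_Istar_succ [HenselianLocalRing R] (J : WeierstrassCurve R)
    (hΔ : J.Δ ≠ 0) (h1 : J.a₁ ∈ maximalIdeal R) (h2 : J.a₂ ∈ maximalIdeal R)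
    (h2' : J.a₂ ∉ maximalIdeal R ^ 2) (h3 : J.a₃ ∈ maximalIdeal R ^ 2)
    (h4 : J.a₄ ∈ maximalIdeal R ^ 3) (h6 : J.a₆ ∈ maximalIdeal R ^ 4) :
    (J.nonsingularReductionSubgroup (integers_valuationRing_valuation R K)).index = 2 ∨
      (J.nonsingularReductionSubgroup (integers_valuationRing_valuation R K)).index = 4 := by
  have hϖ : Irreducible (uniformizer R) := irreducible_uniformizer
  set ϖ := uniformizer R with hϖdef
  set H := J.nonsingularReductionSubgroup (integers_valuationRing_valuation R K) with hH
  have hinj := IsFractionRing.injective R K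
  have hm : ϖ ∈ maximalIdeal R := (IsLocalRing.mem_maximalIdeal _).mpr hϖ.not_isUnit
  have hres0 : residue R ϖ = 0 := (residue_eq_zero_iff _).mpr hm; obtain ⟨α, hα⟩ :=
    mem_maximalIdeal_iff_dvd.mp h1
  obtain ⟨p, hp⟩ := mem_maximalIdeal_iff_dvd.mp h2
  have hpu : IsUnit p := by
    refine IsLocalRing.notMem_maximalIdeal.mp fun hpm => h2' ?_
    rw [mem_maximalIdeal_pow_iff_dvd, hp, pow_two]
    exact mul_dvd_mul_left _ (mem_maximalIdeal_iff_dvd.mp hpm)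
  have hpres : residue R p ≠ 0 := (isUnit_iff_residue_ne_zero p).mp hpu
  obtain ⟨γ, hγ⟩ := mem_maximalIdeal_pow_iff_dvd.mp h3
  obtain ⟨q, hq⟩ := mem_maximalIdeal_pow_iff_dvd.mp h4
  obtain ⟨w, hw⟩ := mem_maximalIdeal_pow_iff_dvd.mp h6
  have hδ : J.a₄ = ϖ ^ 2 * (ϖ * q) := by rw [hq]; ring
  have hε : J.a₆ = ϖ ^ 3 * (ϖ * w) := by rw [hw]; ring
  have h3' := Ideal.pow_le_self two_ne_zero h3; have h4' := Ideal.pow_le_self three_ne_zero h4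
  have h6' := Ideal.pow_le_self four_ne_zero h6
  -- bad points: `(ϖ x₁, ϖ² y₂)` with `x̄₁ = 0` or `x̄₁ = -p̄`
  have hbad : ∀ P : (J.baseChange K).toAffine.Point, ¬ J.HasNonsingularReduction P →
      ∃ (x₁ y₂ : R) (h : (J.baseChange K).toAffine.Nonsingular (algebraMap R K (ϖ * x₁))
        (algebraMap R K (ϖ ^ 2 * y₂))), P = .some _ _ h ∧
          (residue R x₁ = 0 ∨ residue R x₁ = -residue R p) := by
    intro P hP
    obtain ⟨x₁, y₂, h, rfl, hid⟩ :=
      exists_root_of_not_hasNonsingularReduction J hϖ hα hp hγ hδ hε hP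
    refine ⟨x₁, y₂, h, rfl, ?_⟩
    have := congrArg (residue R) hid
    simp only [map_add, map_mul, map_pow, hres0, zero_mul, add_zero] at this
    have h0 : residue R x₁ ^ 2 * (residue R x₁ + residue R p) = 0 := by linear_combination this
    rcases mul_eq_zero.mp h0 with h | h
    · exact Or.inl (pow_eq_zero_iff two_ne_zero |>.mp h)
    · exact Or.inr (by linear_combination h)
  choose! fx fy fh hPeq hside using hbad
  have hfx : ∀ (x₁ : R) (y : K) (h : (J.baseChange K).toAffine.Nonsingular
      (algebraMap R K (ϖ * x₁)) y), ¬ J.HasNonsingularReduction (.some _ _ h) →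
        fx (.some _ _ h) = x₁ := by
    intro x₁ y h hP
    have e := hPeq _ hP
    simp only [WeierstrassCurve.Affine.Point.some.injEq] at e
    exact (mul_left_cancel₀ hϖ.ne_zero (hinj e.1)).symm
  have hbadpt : ∀ (x₁ : R) (y : K) (h : (J.baseChange K).toAffine.Nonsingular
      (algebraMap R K (ϖ * x₁)) y), ¬ J.HasNonsingularReduction (.some _ _ h) :=
    fun x₁ y h => not_hasNonsingularReduction_of_X_mem J h3' h4' h6'
      (Ideal.mul_mem_right _ _ hm) h rfl
  have hS : ∀ P Q, ¬ J.HasNonsingularReduction P → ¬ J.HasNonsingularReduction Q →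
      residue R (fx P) = -residue R p → residue R (fx Q) = -residue R p → P + Q ∈ H := by
    intro P Q hP hQ hPs hQs
    rw [hPeq P hP, hPeq Q hQ, hH, WeierstrassCurve.mem_nonsingularReductionSubgroup_iff]
    refine hasNonsingularReduction_add_of_same_root J hϖ hα hp hγ hδ hε (hPs.trans hQs.symm) ?_
      (fh P hP) (fh Q hQ)
    rw [hPs]
    simp only [map_mul, hres0, zero_mul, add_zero]
    have e : 3 * (-residue R p) ^ 2 + 2 * residue R p * -residue R p = residue R p ^ 2 := by ring
    rw [e]
    exact pow_ne_zero 2 hpres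
  -- a point over the simple root: `(ϖ t, 0)` with `t` a Hensel root of `T³ + pT² + ϖqT + ϖw`
  obtain ⟨t, ht, ht₀⟩ : ∃ t : R, t ^ 3 + p * t ^ 2 + ϖ * q * t + ϖ * w = 0 ∧
      t - (-p) ∈ maximalIdeal R := by
    set g : R[X] := X ^ 3 + C p * X ^ 2 + C (ϖ * q) * X + C (ϖ * w) with hg
    have hmonic : g.Monic := by rw [hg]; monicity!
    have hev : ∀ x, g.eval x = x ^ 3 + p * x ^ 2 + ϖ * q * x + ϖ * w := by
      intro x; simp [hg]
    have hev' : ∀ x, g.derivative.eval x = 3 * x ^ 2 + 2 * p * x + ϖ * q := by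
      intro x; simp [hg]; ring
    have h₁ : g.eval (-p) ∈ maximalIdeal R := by
      rw [hev]
      have e : (-p) ^ 3 + p * (-p) ^ 2 + ϖ * q * -p + ϖ * w = ϖ * (w - q * p) := by ring
      rw [e]; exact Ideal.mul_mem_right _ _ hm
    have h₂ : IsUnit (g.derivative.eval (-p)) := by
      rw [hev']
      have e : 3 * (-p) ^ 2 + 2 * p * -p + ϖ * q = p ^ 2 + ϖ * q := by ring
      rw [e]; exact isUnit_add_mul_of_isUnit hϖ (hpu.pow 2) q
    obtain ⟨t, ht, ht₀⟩ := HenselianLocalRing.is_henselian g hmonic (-p) h₁ h₂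
    exact ⟨t, by rw [← hev]; exact ht, ht₀⟩
  have hΔK : (J.baseChange K).Δ ≠ 0 := by
    rw [WeierstrassCurve.baseChange, WeierstrassCurve.map_Δ]; exact (map_ne_zero_iff _ hinj).mpr hΔ
  have hns₀ := (WeierstrassCurve.Affine.equation_iff_nonsingular_of_Δ_ne_zero hΔK).mp
    ((WeierstrassCurve.Affine.map_equation _ hinj (ϖ * t) 0).mpr (by
      rw [WeierstrassCurve.Affine.equation_iff, hp, hq, hw]; linear_combination (-(ϖ ^ 3)) * ht))
  set P₀ : (J.baseChange K).toAffine.Point := .some _ _ hns₀ with hP₀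
  have hP₀bad : ¬ J.HasNonsingularReduction P₀ := hbadpt t _ hns₀
  have hP₀s : residue R (fx P₀) = -residue R p := by
    rw [hP₀, hfx t _ hns₀ hP₀bad]
    have := (residue_eq_zero_iff _).mpr ht₀
    rw [map_sub, map_neg, sub_eq_zero] at this
    exact this
  -- the quotient and the class `s`
  set Q := (J.baseChange K).toAffine.Point ⧸ H with hQ
  set s : Q := QuotientAddGroup.mk P₀ with hs
  have hs0 : s ≠ 0 := fun h => hP₀bad ((WeierstrassCurve.mem_nonsingularReductionSubgroup_iff _).mp
    ((QuotientAddGroup.eq_zero_iff P₀).mp h))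
  have h2s : s + s = 0 := by
    rw [hs, ← QuotientAddGroup.mk_add, QuotientAddGroup.eq_zero_iff]
    exact hS P₀ P₀ hP₀bad hP₀bad hP₀s hP₀s
  -- every point over the simple root has class `s`
  have hSclass : ∀ P, ¬ J.HasNonsingularReduction P → residue R (fx P) = -residue R p →
      (QuotientAddGroup.mk P : Q) = s := by
    intro P hP hPs
    have e : (QuotientAddGroup.mk P : Q) + s = 0 := by
      rw [hs, ← QuotientAddGroup.mk_add, QuotientAddGroup.eq_zero_iff]
      exact hS P P₀ hP hP₀bad hPs hP₀s
    rw [show s = -s by rw [eq_neg_iff_add_eq_zero, h2s]]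
    exact eq_neg_of_add_eq_zero_left e
  -- two points over the double root: classes differ by `0` or `s`
  have hDclass : ∀ P P', ¬ J.HasNonsingularReduction P → ¬ J.HasNonsingularReduction P' →
      residue R (fx P) = 0 → residue R (fx P') = 0 →
        (QuotientAddGroup.mk P : Q) + QuotientAddGroup.mk P' = 0 ∨
          (QuotientAddGroup.mk P : Q) + QuotientAddGroup.mk P' = s := by
    intro P P' hP hP' hPd hP'd
    rw [← QuotientAddGroup.mk_add, hPeq P hP, hPeq P' hP']
    have hx₁ : fx P ∈ maximalIdeal R := (residue_eq_zero_iff _).mp hPd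
    have hx₁' : fx P' ∈ maximalIdeal R := (residue_eq_zero_iff _).mp hP'd
    rcases add_of_side_D J hϖ h1 hp h3' h4' h6' hx₁ hx₁' (fh P hP) (fh P' hP') with hgood |
      ⟨X, Y, h₃, hsum, hX⟩
    · exact Or.inl ((QuotientAddGroup.eq_zero_iff _).mpr
        ((WeierstrassCurve.mem_nonsingularReductionSubgroup_iff _).mpr hgood))
    · right
      rw [hsum]
      have hbad₃ := hbadpt X Y h₃
      exact hSclass _ hbad₃ (by rw [hfx X Y h₃ hbad₃]; exact hX)
  have hneg_bad : ∀ P : (J.baseChange K).toAffine.Point, ¬ J.HasNonsingularReduction P →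
      ¬ J.HasNonsingularReduction (-P) := by
    intro P hP hn
    apply hP
    have := H.neg_mem ((WeierstrassCurve.mem_nonsingularReductionSubgroup_iff _).mpr hn)
    rw [neg_neg] at this
    exact (WeierstrassCurve.mem_nonsingularReductionSubgroup_iff _).mp this
  have hfx_neg : ∀ P, ¬ J.HasNonsingularReduction P → fx (-P) = fx P := by
    intro P hP
    have hn := hneg_bad P hP
    have e : -P = WeierstrassCurve.Affine.Point.some _ _
        ((WeierstrassCurve.Affine.nonsingular_neg _ _).mpr (fh P hP)) := by
      conv_lhs => rw [hPeq P hP]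
      rfl
    rw [e] at hn ⊢
    exact hfx _ _ _ hn
  have hcover : ∀ q : Q, q = 0 ∨ q = s ∨ ∃ P, ¬ J.HasNonsingularReduction P ∧
      residue R (fx P) = 0 ∧ q = QuotientAddGroup.mk P := by
    intro q
    induction q using QuotientAddGroup.induction_on with
    | H P =>
      by_cases hP : J.HasNonsingularReduction P
      · exact Or.inl ((QuotientAddGroup.eq_zero_iff P).mpr
          ((WeierstrassCurve.mem_nonsingularReductionSubgroup_iff _).mpr hP))
      · rcases hside P hP with hd | hsd
        · exact Or.inr (Or.inr ⟨P, hP, hd, rfl⟩)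
        · exact Or.inr (Or.inl (hSclass P hP hsd))
  have hle4 : ∃ F : Finset Q, ∀ q : Q, q ∈ F ∧ F.card ≤ 4 := by
    by_cases hD : ∃ P, ¬ J.HasNonsingularReduction P ∧ residue R (fx P) = 0
    · obtain ⟨P₁, hP₁, hP₁d⟩ := hD
      set d : Q := QuotientAddGroup.mk P₁ with hd
      refine ⟨{0, s, d, d + s}, fun q => ⟨?_, ?_⟩⟩
      · rcases hcover q with rfl | rfl | ⟨P, hP, hPd, rfl⟩
        · simp
        · simp
        · -- `[P] - [P₁] ∈ {0, s}` via `[P] + [-P₁]`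
          have hn := hneg_bad P₁ hP₁
          have key := hDclass P (-P₁) hP hn hPd (by rw [hfx_neg P₁ hP₁]; exact hP₁d)
          rw [QuotientAddGroup.mk_neg, ← sub_eq_add_neg] at key
          rcases key with h0 | h1
          · have : (QuotientAddGroup.mk P : Q) = d := by rw [hd]; exact sub_eq_zero.mp h0
            simp [this]
          · have : (QuotientAddGroup.mk P : Q) = d + s := by rw [hd]; exact sub_eq_iff_eq_add'.mp h1
            simp [this]
      · exact (Finset.card_le_four)
    · refine ⟨{0, s}, fun q => ⟨?_, (Finset.card_le_two).trans (by norm_num)⟩⟩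
      rcases hcover q with rfl | rfl | ⟨P, hP, hPd, rfl⟩
      · simp
      · simp
      · exact (hD ⟨P, hP, hPd⟩).elim
  obtain ⟨F, hF⟩ := hle4
  haveI : Finite Q := by
    refine Finite.of_injective (fun q => (⟨q, (hF q).1⟩ : F)) fun a b h => ?_
    simpa using h
  have hcard_le : Nat.card Q ≤ 4 := by
    have h1 := Nat.card_le_card_of_injective (fun q => (⟨q, (hF q).1⟩ : F))
      (fun a b h => by simpa using h)
    rw [Nat.card_eq_fintype_card (α := ↥F), Fintype.card_coe] at h1
    exact h1.trans (hF 0).2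
  -- `2 ∣ #Q` (the class `s` has order `2`)
  have hdvd : 2 ∣ Nat.card Q := by
    have hord : addOrderOf s = 2 := by
      refine (addOrderOf_eq_prime_iff (p := 2)).mpr ⟨?_, hs0⟩
      rw [two_nsmul]; exact h2s
    rw [← hord]; exact addOrderOf_dvd_natCard s
  have hpos : 0 < Nat.card Q := Nat.card_pos
  rw [AddSubgroup.index]
  change Nat.card Q = 2 ∨ Nat.card Q = 4
  omega

/-- **`[E(K) : E₀(K)] ∈ {2, 4}` for type `Iₙ*`, `n ≥ 1`** over a Henselian discrete valuation
ring with perfect residue field (Silverman, *ATAEC*, IV.9.4 Step 7: `c = 2` or `4`), for an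
equation `I` with `Δ ≠ 0`. [cite: SilvermanATAEC1994, IV.9.4 Step 7] -/
theorem index_mem_of_kodairaSymbolOfMinimal_eq_Istar_succ [HenselianLocalRing R]
    [PerfectField (ResidueField R)] (I : WeierstrassCurve R) (hΔ : I.Δ ≠ 0) {n : ℕ}
    (hI : I.kodairaSymbolOfMinimal = .Istar (n + 1)) :
    (I.nonsingularReductionSubgroup (integers_valuationRing_valuation R K)).index = 2 ∨
      (I.nonsingularReductionSubgroup (integers_valuationRing_valuation R K)).index = 4 := by
  obtain ⟨D, h1, h2, h2', h3, h4, h6⟩ := exists_smul_of_kodairaSymbolOfMinimal_eq_Istar_succ I hI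
  rw [← index_nonsingularReductionSubgroup_smul I D]
  refine index_mem_of_normalForm_Istar_succ (D • I) ?_ h1 h2 h2' h3 h4 h6
  rw [WeierstrassCurve.variableChange_Δ]
  exact mul_ne_zero (pow_ne_zero _ (Units.ne_zero _)) hΔ

end LocalIndex

/-! ### The discharge -/

section Discharge

open IsDedekindDomain

variable {A : Type*} [CommRing A] [IsDedekindDomain A] {K : Type*} [Field K] [Algebra A K]
  [IsFractionRing A K] (v : HeightOneSpectrum A) (W : WeierstrassCurve K)

/-- **Discharge of `localTamagawaNumber_of_kodairaSymbolAt_eq_Istar_succ`**: `c_v ∈ {2, 4}` for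
type `Iₙ*`, `n ≥ 1` (Silverman, *ATAEC*, IV.9.4 Step 7, PDF p. 345), by the elementary argument
of this file over the Henselian ring `O_v`.
[cite: SilvermanATAEC1994, IV.9.4 Step 7 (PDF p. 345)] -/
theorem localTamagawaNumber_of_kodairaSymbolAt_eq_Istar_succ_holds :
    localTamagawaNumber_of_kodairaSymbolAt_eq_Istar_succ v W := by
  intro _ _ n hk
  rw [WeierstrassCurve.kodairaSymbolAt_def] at hk
  haveI := W.isElliptic_localMinimalModel v
  change ((W.localMinimalModel v).goodReductionSubgroup (v.adicCompletionIntegers K)).index = 2 ∨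
    ((W.localMinimalModel v).goodReductionSubgroup (v.adicCompletionIntegers K)).index = 4
  have key : ∀ (M : WeierstrassCurve (v.adicCompletion K))
      [M.IsMinimal (v.adicCompletionIntegers K)] [M.IsElliptic],
      (M.integralModel (v.adicCompletionIntegers K)).kodairaSymbolOfMinimal = .Istar (n + 1) →
        (M.goodReductionSubgroup (v.adicCompletionIntegers K)).index = 2 ∨
        (M.goodReductionSubgroup (v.adicCompletionIntegers K)).index = 4 := by
    intro M _ _ hM
    obtain ⟨I, rfl⟩ : ∃ I : WeierstrassCurve (v.adicCompletionIntegers K),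
        M = I.baseChange (v.adicCompletion K) := WeierstrassCurve.IsIntegral.integral
    rw [WeierstrassCurve.integralModel_baseChange_eq] at hM
    rw [WeierstrassCurve.goodReductionSubgroup_baseChange_eq]
    refine LocalIndex.index_mem_of_kodairaSymbolOfMinimal_eq_Istar_succ I ?_ hM
    intro h0
    apply (I.baseChange (v.adicCompletion K)).Δ'.ne_zero
    rw [WeierstrassCurve.coe_Δ', WeierstrassCurve.baseChange, WeierstrassCurve.map_Δ, h0, map_zero]
  exact key (W.localMinimalModel v) hk

end Discharge

end Literature.NumberTheory.EllipticCurves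

end
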